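import Literature.NumberTheory.DiophantineApproximation.RhinViolaOuterResidue
import Mathlib.Algebra.Polynomial.Roots
import Mathlib.Order.Interval.Set.Infinite
import HarnessLib

/-!
# The linear decomposition (2.41) for Rhin–Viola's double contour integral `I_z^{(2)}`

Topic `Literature/NumberTheory/DiophantineApproximation`. Everything here is PROVED (no definitions, no named
facts). Source: G. Rhin, C. Viola, *The permutation group method for the dilogarithm*, Ann. Sc. Norm. Super.
Pisa (5) 4 (2005) 389–437, (2.40)–(2.41): the identity `(1−x)(1−y) = z − (z−1)(1−y) − (x(1−y)+yz)` in the
numerator gives, for all three members `ν = 0, 1, 2`,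

  `I_z^{(ν)}(h+1,j,k,l+1,m) = I_z^{(ν)}(h,j,k,l,m) − (z−1) I_z^{(ν)}(h,j,k,l+1,m) − I_z^{(ν)}(h,j,k,l,m+1)`  (2.41).

For `ν = 0, 1` this is `I0_succ_h_succ_l`, `I1_succ_h_succ_l`. Here we prove it for the double residue
`RhinViola.I2`, using the polynomial model of the outer residue (`RhinViolaOuterResidue.lean`): every outer
integrand `x^j(1−x)^h·innerRes z j k l m x` is `G(x)/(x−z)^N` off `x = z` with `I2 = z^{−l−m}(D^{(N−1)}G)(z)`
(`exists_outer_rep`, also in the degenerate case `j+k < m` with `G = 0`); the value `(D^{(N−1)}G)(z)` depends only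
on the FUNCTION `G(x)/(x−z)^N` (`hasseDeriv_eval_eq_of_eval_div_eq`: two representations agree off `z`, hence as
polynomials after clearing denominators, and the shift invariance applies); so the pointwise identity
`(1−x)·innerRes(j,k,l+1,m) = z·innerRes(j,k,l,m) − (z−1)·innerRes(j,k,l+1,m) − innerRes(j,k,l,m+1)`
(`one_sub_mul_innerRes_succ_l`) passes to the residues by linearity.

## References

* G. Rhin, C. Viola, Ann. Sc. Norm. Super. Pisa Cl. Sci. (5) 4 (2005) 389–437, (2.41). [RhinViola2005]
-/

noncomputable section

namespace Literature.NumberTheory.DiophantineApproximation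

namespace RhinViola

open Finset Polynomial

/-- **The polynomial residue depends only on the function**: if `G₁(x)/(x−z)^{N₁} = G₂(x)/(x−z)^{N₂}` for all
`x ≠ z` (`N₁, N₂ ≥ 1`), then `(D^{(N₁−1)}G₁)(z) = (D^{(N₂−1)}G₂)(z)`. [folklore] -/
theorem hasseDeriv_eval_eq_of_eval_div_eq {z : ℝ} {G₁ G₂ : ℝ[X]} {N₁ N₂ : ℕ} (h₁ : 1 ≤ N₁) (h₂ : 1 ≤ N₂)
    (h : ∀ x : ℝ, x ≠ z → G₁.eval x / (x - z) ^ N₁ = G₂.eval x / (x - z) ^ N₂) :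
    (hasseDeriv (N₁ - 1) G₁).eval z = (hasseDeriv (N₂ - 1) G₂).eval z := by
  -- clearing denominators: `G₁ (X−z)^{N₂} = G₂ (X−z)^{N₁}` as polynomials (they agree off `z`)
  have hpoly : G₁ * (X - C z) ^ N₂ = G₂ * (X - C z) ^ N₁ := by
    refine eq_of_infinite_eval_eq _ _ ((Set.Ioi_infinite z).mono fun x hx => ?_)
    have hxz : x - z ≠ 0 := sub_ne_zero.2 (ne_of_gt hx)
    have hx := h x (ne_of_gt hx)
    rw [div_eq_div_iff (pow_ne_zero _ hxz) (pow_ne_zero _ hxz)] at hx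
    simp only [Set.mem_setOf_eq, eval_mul, eval_pow, eval_sub, eval_X, eval_C]
    exact hx
  rw [← hasseDeriv_mul_X_sub_C_pow_eval z G₁ (N₁ - 1) N₂, ← hasseDeriv_mul_X_sub_C_pow_eval z G₂ (N₂ - 1) N₁,
    hpoly, show N₁ - 1 + N₂ = N₂ - 1 + N₁ by omega]

/-- **Every outer integrand has a polynomial-residue representation**: there are `G ∈ ℝ[X]` and `N ≥ 1` with
`x^j(1−x)^h·innerRes z j k l m x = G(x)/(x−z)^N` for `x ≠ z` and `I2 z h j k l m = z^{−l−m}(D^{(N−1)}G)(z)`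
(for `m ≤ j+k` the explicit `G` of `outerIntegrand_eq_div`; for `j+k < m` both sides vanish, `G = 0`).
[cite: RhinViola2005, (2.3)] -/
theorem exists_outer_rep (z : ℝ) (h j k l m : ℕ) :
    ∃ (G : ℝ[X]) (N : ℕ), 1 ≤ N ∧
      (∀ x : ℝ, x ≠ z → x ^ j * (1 - x) ^ h * innerRes z j k l m x = G.eval x / (x - z) ^ N) ∧
      I2 z h j k l m = z ^ (-((l : ℤ) + m)) * (hasseDeriv (N - 1) G).eval z := by
  by_cases hm : m ≤ j + k
  · refine ⟨_, j + k - m + 1 + (k + l), by omega, fun x hxz => outerIntegrand_eq_div hxz hm h, ?_⟩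
    rw [I2_eq_hasseDeriv_eval z hm h, show j + k - m + 1 + (k + l) - 1 = j + k - m + (k + l) by omega]
  · refine ⟨0, 1, le_rfl, fun x _ => ?_, ?_⟩
    · rw [innerRes_of_lt (by omega), eval_zero, mul_zero, zero_div]
    · rw [I2_of_lt h (by omega)]
      simp

/-- **Rhin–Viola (2.41) for `I_z^{(2)}`**:
`I2 z (h+1) j k (l+1) m = I2 z h j k l m − (z−1)·I2 z h j k (l+1) m − I2 z h j k l (m+1)` (`z ≠ 0`).
[cite: RhinViola2005, (2.41)] -/
theorem I2_succ_h_succ_l {z : ℝ} (hz : z ≠ 0) (h j k l m : ℕ) :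
    I2 z (h + 1) j k (l + 1) m = I2 z h j k l m - (z - 1) * I2 z h j k (l + 1) m - I2 z h j k l (m + 1) := by
  obtain ⟨Ga, Na, hNa, hfa, hIa⟩ := exists_outer_rep z (h + 1) j k (l + 1) m
  obtain ⟨G₁, N₁, hN₁, hf₁, hI₁⟩ := exists_outer_rep z h j k l m
  obtain ⟨G₂, N₂, hN₂, hf₂, hI₂⟩ := exists_outer_rep z h j k (l + 1) m
  obtain ⟨G₃, N₃, hN₃, hf₃, hI₃⟩ := exists_outer_rep z h j k l (m + 1)
  -- the right-hand combination as ONE representation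
  set GR : ℝ[X] := z • (G₁ * (X - C z) ^ (N₂ + N₃)) - (z - 1) • (G₂ * (X - C z) ^ (N₁ + N₃)) -
    G₃ * (X - C z) ^ (N₁ + N₂) with hGR
  have hrep : ∀ x : ℝ, x ≠ z → Ga.eval x / (x - z) ^ Na = GR.eval x / (x - z) ^ (N₁ + N₂ + N₃) := by
    intro x hxz
    have hxz' : x - z ≠ 0 := sub_ne_zero.2 hxz
    -- the pointwise identity of outer integrands
    have key : x ^ j * (1 - x) ^ (h + 1) * innerRes z j k (l + 1) m x =
        z * (x ^ j * (1 - x) ^ h * innerRes z j k l m x)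
          - (z - 1) * (x ^ j * (1 - x) ^ h * innerRes z j k (l + 1) m x)
          - x ^ j * (1 - x) ^ h * innerRes z j k l (m + 1) x := by
      have e := one_sub_mul_innerRes_succ_l hxz j k l m
      calc x ^ j * (1 - x) ^ (h + 1) * innerRes z j k (l + 1) m x
          = x ^ j * (1 - x) ^ h * ((1 - x) * innerRes z j k (l + 1) m x) := by ring
        _ = x ^ j * (1 - x) ^ h * (z * innerRes z j k l m x - (z - 1) * innerRes z j k (l + 1) m x -
              innerRes z j k l (m + 1) x) := by rw [e]
        _ = _ := by ring
    rw [← hfa x hxz, key, hf₁ x hxz, hf₂ x hxz, hf₃ x hxz, hGR]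
    simp only [eval_sub, eval_smul, eval_mul, eval_pow, eval_X, eval_C, smul_eq_mul]
    rw [pow_add, pow_add, pow_add, pow_add, pow_add]
    field_simp
  have hres := hasseDeriv_eval_eq_of_eval_div_eq hNa (by omega) hrep
  -- the residue of the combination, by linearity and shift invariance
  have hcomb : (hasseDeriv (N₁ + N₂ + N₃ - 1) GR).eval z =
      z * (hasseDeriv (N₁ - 1) G₁).eval z - (z - 1) * (hasseDeriv (N₂ - 1) G₂).eval z -
        (hasseDeriv (N₃ - 1) G₃).eval z := by
    rw [hGR, map_sub, map_sub, LinearMap.map_smul, LinearMap.map_smul, eval_sub, eval_sub, eval_smul,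
      eval_smul, smul_eq_mul, smul_eq_mul,
      show N₁ + N₂ + N₃ - 1 = (N₁ - 1) + (N₂ + N₃) by omega, hasseDeriv_mul_X_sub_C_pow_eval,
      show (N₁ - 1) + (N₂ + N₃) = (N₂ - 1) + (N₁ + N₃) by omega, hasseDeriv_mul_X_sub_C_pow_eval,
      show (N₂ - 1) + (N₁ + N₃) = (N₃ - 1) + (N₁ + N₂) by omega, hasseDeriv_mul_X_sub_C_pow_eval]
  rw [hIa, hI₁, hI₂, hI₃, hres, hcomb]
  -- the powers of `z`
  have e1 : z ^ (-(((l + 1 : ℕ) : ℤ) + m)) = z⁻¹ * z ^ (-((l : ℤ) + m)) := by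
    rw [show (-(((l + 1 : ℕ) : ℤ) + m)) = -((l : ℤ) + m) - 1 by push_cast; ring, zpow_sub_one₀ hz]
    ring
  have e2 : z ^ (-((l : ℤ) + ((m + 1 : ℕ) : ℤ))) = z⁻¹ * z ^ (-((l : ℤ) + m)) := by
    rw [show (-((l : ℤ) + ((m + 1 : ℕ) : ℤ))) = -((l : ℤ) + m) - 1 by push_cast; ring, zpow_sub_one₀ hz]
    ring
  rw [e1, e2]
  field_simp

end RhinViola

end Literature.NumberTheory.DiophantineApproximation

end
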